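import Summits.CriticalPhenomena.CardyFormulaZ2.Theorems.CardyComplexConeParafermionToSLESixFamiliesIicRectilinear
import Summits.CriticalPhenomena.CardyFormulaZ2.Theorems.CardyComplexConeParafermionToSLESixFamiliesIicDiagArmLower
import Summits.CriticalPhenomena.CardyFormulaZ2.Theorems.CardyComplexConeParafermionToSLESixFamiliesIicWeightedGreen
import Summits.CriticalPhenomena.CardyFormulaZ2.Theorems.CardyComplexConeParafermionToSLESixFamiliesIicTouchPassage
import Summits.CriticalPhenomena.CardyFormulaZ2.Theorems.CardyComplexConeParafermionToSLESixFamiliesBergmanSplit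
import Summits.CriticalPhenomena.CardyFormulaZ2.Theorems.CardyComplexConeParafermionToSLESixFamiliesDefs
import Summits.CriticalPhenomena.CardyFormulaZ2.Theorems.CardyComplexConeParafermionToSLESixFamiliesFlipDefs
import Summits.CriticalPhenomena.CardyFormulaZ2.Theorems.CardyComplexConeParafermionToSLESixFamiliesFlipAllDomainsOfDiag
import Summits.CriticalPhenomena.CardyFormulaZ2.Theorems.CardyComplexConeParafermionToSLESixFamiliesFlipDiagArmLowerOfIkhlefPonsaing
import Summits.CriticalPhenomena.CardyFormulaZ2.Theorems.CardyComplexConeParafermionToSLESixFamiliesFlipMesoEnvelopeOfUniformInnerEnvelope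
import Summits.CriticalPhenomena.CardyFormulaZ2.Theorems.CardyComplexConeParafermionToSLESixFamiliesFlipTouchLawDiagAudit
import Summits.CriticalPhenomena.CardyFormulaZ2.Theorems.CardyComplexConeParafermionToSLESixFamiliesFlipReturnLaw
import Summits.CriticalPhenomena.CardyFormulaZ2.Theorems.CardyComplexConeParafermionToSLESixFamiliesFlipStaggerSummedOfTilt
import Summits.CriticalPhenomena.CardyFormulaZ2.Theorems.ParafermionToSLESixFamilies.Negative.FoliationIdentificationFalse
import Literature.Probability.LatticeModels.FKExplorationDomainMarkov
import Literature.Analysis.Complex.StripPositivityRigidityWeak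
import HarnessLib.Audit

/-!
# Line `flip-involution-return-law` for the crux `ParafermionToSLESixFamilies`
(stmt-CriticalPhenomena-11389, route `CardyComplexCone` rev 3, sub-problem `CriticalPhenomena/CardyFormulaZ2`)
— checked skeleton (crux-plan, opening; planner `planner-cruxplan-stmt-CriticalPhenomena-11389-flip-involution-retu-0`)

Crux (verbatim, `crux_iff`): `WeakHolFamilies → PrecompactFamilies → SLESixAllFamilies` (A → B → C; C is the
open named conjecture `SLE6LimitZ2AllDiscretisations` unbundled, `Disproof.lean` §0; blocks from `…IicDefs`).
By `Disproof.lean` §4–§5 every line must CREATE non-degeneracy N, identification I and slit uniformity U; A and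
B contribute "subsequential limits of `δ^{-1/3}F_δ` exist and are holomorphic" and nothing else, and are used
below for exactly that (hypotheses of `stub_staggerSummed`, `stub_touchLawDiag`).

## The idea (card `Ideas/flip-involution-return-law.md`, ideator 5, round 2; triage r2-1 / r2-2: pass, "merge
with the companion card `bergman-split-sum-rules` into ONE line" — done here)

THE LEVER (`stub_returnLaw`, new, provable now). Orient every medial edge by its configuration-independent
direction of travel; at a lattice edge `z` the diagonal-staggered corner mode `S = G(NW) − G(NE) + G(SE) − G(SW)`
(`IicTraceFluxPairing.stagger`) is `±E[Σ_visits (phase on arrival − phase on departure)]`. A FIRST visit to a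
FREE edge turns by a fair coin `τ₁ = ±1` decided by the state of `z` alone, and the FLIP INVOLUTION
`ω ↦ ω △ {z}` (measure preserving, preserving the prefix up to the first arrival) shows that exactly one state
of `z` produces a return, which arrives antiparallel (arrival winding shifted by `−τ₁π`: Umlaufsatz on the
JORDAN carrier — false on annuli, triage r2-1) and is forced to turn by `τ₂ = τ₁`. Hence three EXACT
finite-volume identities (`ReturnLaw`) through the first-visit amplitude `S₁ = E[Φ₁]` and the phase-weighted
returns `Y± = E[Φ₁ ; return, τ₁ = ±1]`:
`F = cos(π/12)·S₁ + e^{iπ/4}Y₊ + e^{−iπ/4}Y₋`, `S_inout = (1 − √3/2)·S₁ + g(1)Y₊ + g(−1)Y₋`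
(`g(τ) = e^{iτπ/3} − e^{iτπ/6}`), `Y₊ + Y₋ = S₁/2`. So the staggered-mode input S3 that killed line
`iic-trace-flux-pairing` is EQUIVALENT to one local phase-tilt law `Y₊/S₁ → w⋆ = 1/4 − i(2−√3)/4`
(`inOut_eq_tilt_form`; MC `Im = −0.06699 ± 1e-4` vs `−(2−√3)/4 = −0.066987` at L = 64…512, `Re − 1/4 ∝ δ`,
`|S|/|F| ∝ δ` in the bulk and `≈ 0.02·δ/depth` at walls: kit j020697, j020773), which `stub_staggerSummed`
asks for only in the SUMMED (`L¹` on compacts) form that the pairing consumes (triage r2-2 sharpening).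

THE FRAME (companion card). Bergman split of the weighted half-CR Green identity (LANDED:
`IicTraceFluxPairing.sum_weighted_halfCRForm_eq`, `BergmanSplit.coeff_mul_conj_sub` — antiholomorphic weights
pair only `F` —, `BergmanSplit.coeff_mul_sub` — holomorphic weights pair only `S`): with B (bulk), the
mesoscopic envelope (collar, `stub_mesoEnvelope`) and crude RSW (thin layer) the phased touch measure
`δ^{2/3}ν_δ` (EXACT lattice phases, DC12 Prop. 5 = `…IicTouchPassage`; MONOTONE masses) is tight, its
anti-analytic moments are those of `f dz`, and summed S0 kills its analytic moments; on ALL-DIAGONAL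
Dobrushin polygons (`IsDiagRectilinear`: every side of slope `±1`, where phases and corner densities are
lattice-determined side by side and N is the DIAGONAL arm bound `stub_diagArmLower`, conditional on
Ikhlef–Ponsaing in the tree) positivity + strip rigidity (`strip_rigidity_of_nonneg_weak_boundary_values`,
p98965) identify the boundary trace: the positive touch law `TouchLawPosDiag` (`stub_touchLawDiag`, I + N).
Endgame = the dead line's S6–S7 in diagonal geometry: pinned touch laws + Doob martingales + Loewner/Lévy
identify subsequential interface laws on diagonal polygons (`stub_identDiag`, U), `slesixAlong_of_ident`
(LANDED) gives SLE₆ along their families, and `stub_allDomainsOfDiag` (diagonal sandwich ⇒ Cardy ⇒ Camia–Newman)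
gives block C.

Lead a2 (prover-line-stmt-CriticalPhenomena-11389-a2-0), cycle 1 RESHAPE: `ReturnLaw` restricted to INTERIOR
free edges (both endpoints off both arcs; see its docstring); vocabulary §1–§2 to be shared through the
definitions module `Theorems/CardyComplexConeParafermionToSLESixFamiliesFlipDefs.lean` (LANDED p133495).

Registered stubs (sorries live ONLY here): `stub_tiltLawSummed` (reshape of `stub_staggerSummed`), `stub_mesoEnvelope`,
`stub_diagArmLower`, `stub_touchLawDiag`, `stub_identDiag`, `stub_allDomainsOfDiag` — and `stub_returnLaw`, LANDED (imported).
`ParafermionToSLESixFamilies_of` concludes the route declaration BY NAME from exactly these seven statements;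
`ParafermionToSLESixFamilies_of_stubs` feeds it the stubs. Conditional status of N made kernel-visible:
`diagArmLower_of_ikhlefPonsaing : IkhlefPonsaingFirstPassage → DiagHalfPlaneOneArmLower` (landed p119507).

Disproof used (`Cruxes/ParafermionToSLESixFamilies/Disproof.lean` v4): §2 — no `_false_without_` theorem exists,
none to honour; §4 `crux_iff_conjecture_of_not_nonDegenerate` — N is the explicit stub `stub_diagArmLower`
(never smuggled into an interface); §5 `hypotheses_of_holoWorld` / `oneSided_even_with_nonDegeneracy` — I is
created from BOUNDARY data (phased touch measure of monotone events) in `stub_touchLawDiag`, U in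
`stub_identDiag`; §3 edge guards — every lattice statement below lives on lattice edges (`IsFreeEdge`,
`(zdGraph 2).edgeSet`, `medialVertexOf`) of Jordan admissible data. Landed Negative lemma
`…Negative.not_FoliationIdentification` (imported): no stub is an instance (no harmonic-foliation statement).
Dead lines honoured: `iic-trace-flux-pairing` died at S1/S2/S3 — here S3 ↦ RL + summed tilt law (new KIND of
statement), S1 ↦ mesoscopic envelope (thin layer free, any `a < 1`), S2 (axis, hardness p120880) ↦ NOT USED,
N is diagonal; `caratheodory-net-slit-uniformity` died at U′ (`CarrierEquicontinuity`) — not used.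
-/

noncomputable section

open scoped Topology NNReal ENNReal BigOperators Classical
open Filter Set MeasureTheory Metric
open Literature.Probability Literature.Probability.LatticeModels Literature.Probability.Percolation
open Literature.Probability.RandomPlanarGeometry
open Literature.Barriers.CriticalPhenomena (medialVertexOf)
open Summit.CriticalPhenomena.CardyFormulaZ2.Theses.CardyComplexCone (ParafermionToSLESixFamilies)
open Summit.CriticalPhenomena.CardyFormulaZ2.Cruxes.ParafermionToSLESixFamilies.IicTraceFluxPairing
open Summit.CriticalPhenomena.CardyFormulaZ2.Cruxes.ParafermionToSLESixFamilies.CaratheodoryNetSlitUniformity (obs Pc)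
open Summit.CriticalPhenomena.CardyFormulaZ2.Cruxes.EdgePrecompact.QkzStripBoundaryArm (cornerObs UniformInnerEnvelope)

namespace Summit.CriticalPhenomena.CardyFormulaZ2.Cruxes.ParafermionToSLESixFamilies.FlipInvolutionReturnLaw

/-! ## §0 The crux is `A → B → C` (blocks of `…IicDefs`, verbatim the route declaration) -/

/-- The crux is literally `A → B → C`. -/
theorem crux_iff :
    ParafermionToSLESixFamilies ↔ (WeakHolFamilies → PrecompactFamilies → SLESixAllFamilies) :=
  Iff.rfl

/-! ## §1–§2 Vocabulary and typed statements of the line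

They live, verbatim and sorry-free, in the landed definitions module
`Theorems/CardyComplexConeParafermionToSLESixFamiliesFlipDefs.lean` (p133495; namespace of this file): `arrW`,
`turnSign`, `phase`, `firstPhase`, `inOutSum`, `S1`, `Yplus`, `Yminus`, `inOut`, `gTilt`, `IsDiagDir`,
`IsDiagFreeWindow`, `TouchLawPosDiag`, `IsDiagRectilinear`, `IdentOnDiagRectilinear`, `ReturnLaw` (interior-edge
form), `StaggerSummedVanishing`, `MesoEnvelope`, `DiagHalfPlaneOneArmLower`, and the registered glue
`inOut_eq_tilt_form`. -/

/-! ## §3 The registered stubs -/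

/-! **RL — LANDED** (lead a2, cycle 1): `stub_returnLaw : ReturnLaw` is the theorem of
`Theorems/CardyComplexConeParafermionToSLESixFamiliesFlipReturnLaw.lean` (p136007; helpers p135206 `onceTwice_visits`,
p135372 `visit_dictionary`, p135478 `onceTwice_values`, p135661 `twelve_phases` / `pair_algebra_pos/neg`, p135772
`returnLaw_pair`), imported above; the composition below uses it by name. The dart bookkeeping
`stagger_eq_signed_inOut : stagger E E.δ (x,i) = (−1)^{i+1}·inOut E s(x, x+eᵢ)` (p135976,
`…FlipStaggerInOut.lean`) makes `stub_staggerSummed` literally the summed phase-tilt law. -/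

/-- **S0 in tilt form — the summed phase-tilt law** (L–XL; the load-bearing NEW stub; OPEN). LEAD'S RESHAPE
(a2, cycle 2) of the planner's `stub_staggerSummed : ReturnLaw → PrecompactFamilies → StaggerSummedVanishing`:
with RL landed (`stub_returnLaw`), the dart bookkeeping `stagger_eq_signed_inOut` (p135976) and the interior-edge
lemma of `…FlipStaggerSummedOfTilt.lean`, `StaggerSummedVanishing ↔ TiltLawSummed` is PROVED bookkeeping
(`staggerSummedVanishing_of_tiltLawSummed` / `tiltLawSummed_of_staggerSummedVanishing`), so the stub is now the
pure analytic content: along every family with the crux's guards and every compact `K ⊂ D`,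
`δ^{5/3}·Σ_{z over K} ‖(g(1) − g(−1))·Y₊(z) + ((1 − √3/2) + g(−1)/2)·S₁(z)‖ → 0`, i.e. `Y₊ ≈ w⋆·S₁`,
`w⋆ = 1/4 − i(2−√3)/4`, in `L¹` on compacts at the relative scale. (The hypotheses `ReturnLaw`, B of the old
form are dropped: RL is a theorem, and B does not enter the equivalence.) Intended proof and WHY IT MIGHT FAIL:
as before — local/global split of `Φ₁`, pocket independence, RSW/IIC coupling, phase quasi-multiplicativity;
the `δ^{1/12}` race (coupling errors at the passage scale `δ^{1/4}` against the cancelled amplitude `δ^{1/3}`).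
Numerics: `Im(Y₊/S₁) = −0.06699 ± 1e-4` (kit j020697/j020773). -/
theorem stub_tiltLawSummed : TiltLawSummed := by
  sorry

/-- **MESO** (XL; open, shared with the companion card's planned line): the mesoscopic inner envelope. -/
theorem stub_mesoEnvelope : MesoEnvelope := by
  sorry

/-- **N** (open unconditionally; `IkhlefPonsaingFirstPassage → N` is `diagArmLower_of_ikhlefPonsaing`, landed):
the diagonal half-plane one-arm lower bound. Disproof §4: without an N-type input the crux is the bare
conjecture, so this stub is declared, not hidden. -/
theorem stub_diagArmLower : DiagHalfPlaneOneArmLower := by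
  sorry

/-- **I + N ⇒ the positive touch law on all-diagonal polygons** (XL; research — the companion card's engine, the
dead line's S5 re-cut). From A, B (subsequential limits `f` of `δ^{-1/3}F_δ` exist and are holomorphic — all
they are worth, Disproof §5), summed S0, the mesoscopic envelope and N: test the weighted half-CR Green
identity (`sum_weighted_halfCRForm_eq`) against smooth weights up to the boundary; Bergman split
(`BergmanSplit.coeff_mul_conj_sub` / `coeff_mul_sub`): the `∂̄ψ`-part pairs only `F` (B in the bulk, MESO in
the collar `δ^{1/3−ε} ≤ d ≤ η`, crude RSW in the thin layer ⇒ `δ^{2/3}ν_δ` tight, anti-analytic moments =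
those of `f dz`), the `∂ψ`-part pairs only `S` (summed S0 ⇒ analytic moments vanish); the phases of `ν_δ` are
EXACT per side (`…IicTouchPassage`, DC12 Prop. 5; Umlaufsatz between sides), the masses MONOTONE touch
probabilities; F. & M. Riesz + positivity + strip rigidity (`strip_rigidity_of_nonneg_weak_boundary_values`,
p98965) identify `f = c·(Φ′)^{1/3}` and the boundary trace `c·ρ`, `ρ = HasTouchDensityAt`; N on a diagonal
free side (RSW gluing of `π◇` to the window touch probabilities) pins `c > 0`. WHY IT MIGHT FAIL: the sharp
UPPER bound `δ^{2/3}Σ_side P(touch) = O(1)` on diagonal sides near marks/corners (IP12 only in log form,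
p91076), the two touch-corner sublattices per diagonal period (needs their RSW ratio limit), and Schwarz–
Christoffel growth of the strip map at the polygon's corners inside the rigidity step. -/
theorem stub_touchLawDiag :
    WeakHolFamilies → PrecompactFamilies → StaggerSummedVanishing → MesoEnvelope →
      DiagHalfPlaneOneArmLower → ∀ D : DobrushinDomain, IsDiagRectilinear D → TouchLawPosDiag D := by
  sorry

/-- **U + endgame on all-diagonal polygons** (XL; research — the dead line's S6a+S6b in diagonal geometry):
positive touch laws on diagonal windows ⇒ their slit-uniform PINNED form (one subsequence, one amplitude
serving every exploration prefix: RSW ratio-stability of monotone touch quantities over pinned slit data; the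
window sits on the flat far boundary, never near the rough slit — and RL/the tilt mechanism are local and hold
verbatim for configurations frozen on a revealed prefix, `…PercDomainMarkov`), Doob martingales of the pinned
touch functionals (`…IicTouchPin`, landed for axis windows), Loewner describability of subsequential limits of
the non-simple medial polyline, transport of the window density, the `κ = 6` detector and Lévy
(`…StubSleSixOfLimitData` technology) ⇒ every subsequential interface law on an all-diagonal polygon is chordal
SLE₆. Shares its research content U with `IicTraceFluxPairing.TouchLawPosPin` (S6a). -/
theorem stub_identDiag :
    (∀ D : DobrushinDomain, IsDiagRectilinear D → TouchLawPosDiag D) → IdentOnDiagRectilinear := by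
  sorry

/-- **Transport to block C** (XL; the dead line's S7 in diagonal geometry): SLE₆ along every admissible family of
every all-diagonal polygon ⇒ SLE₆ for all Jordan domains and all families. Pieces: (1) SLE₆ on diagonal
polygons ⇒ Cardy's limit for diagonal-polygonal conformal rectangles (crux 9654's collar-touch-sandwich at
diagonal designer domains); (2) a DIAGONAL twin of `RectilinearSuffices_proof` (Bollobás–Riordan sandwich with
slope-`±1` lattice polygons) ⇒ `CardyFormulaZ2`; (3) Camia–Newman on `ℤ²` (Cardy in all conformal rectangles ⇒
identification on all Jordan domains, CN07 §§5–7; absent for bond-`ℤ²`), then `slesixAllFamilies_of_identAllFamilies`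
(landed). Remark for the tenure planner: pieces (1)+(2) alone already give the ROUTE's target `CardyFormulaZ2`
from SLE₆ on diagonal polygons; piece (3) is forced only because the crux C insists on ALL domains. -/
theorem stub_allDomainsOfDiag :
    (∀ D : DobrushinDomain, IsDiagRectilinear D → ∀ Λ : ℝ → DiscreteDobrushin, IsFamily D Λ → SLESixAlong D Λ) →
      SLESixAllFamilies := by
  sorry

/-! ## §4 Proved glue -/

/-- Identification on all-diagonal polygons ⇒ SLE₆ along every admissible family of every all-diagonal polygon
(tightness and measurability are unconditional: `slesixAlong_of_ident`, landed). -/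
theorem slesixAlong_diag_of_ident (hI : IdentOnDiagRectilinear) :
    ∀ D : DobrushinDomain, IsDiagRectilinear D → ∀ Λ : ℝ → DiscreteDobrushin, IsFamily D Λ → SLESixAlong D Λ :=
  fun D hD Λ hΛ => slesixAlong_of_ident D Λ hΛ (hI D hD Λ hΛ)

/-! ### Landed glue of the line (Theorems modules, namespace of this file)

* `diagArmLower_of_ikhlefPonsaing : IkhlefPonsaingFirstPassage → DiagHalfPlaneOneArmLower`
  (`…FlipDiagArmLowerOfIkhlefPonsaing`, p134439): the conditional status of N, kernel-checked.
* `mesoEnvelope_of_uniformInnerEnvelope : QkzStripBoundaryArm.UniformInnerEnvelope → MesoEnvelope`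
  (`…FlipMesoEnvelopeOfUniformInnerEnvelope`, p134234): MESO sits below crux 11387's X1 chain.
* `allDomainsOfDiag_of : (diag SLE₆ ⇒ diag Cardy) → (CardyFormulaZ2 ⇒ identification on all domains) →
  (∀ D diag, ∀ Λ, IsFamily D Λ → SLESixAlong D Λ) → SLESixAllFamilies`, `cardyFormulaZ2_of_diagCardy` (PIECE 2 of
  the card PROVED: diagonal Bollobás–Riordan sandwich), `exists_isDiagRectilinear`, `exists_isFamily`,
  `exists_isDiagRectilinear_and_isFamily` (unconditional) (`…FlipAllDomainsOfDiag`, p134764).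
* `exists_isDiagRectilinear_isFamily_isDiagFreeWindow`, `isDiagFreeWindow_of_tiltedSquare`,
  `HasTouchDensityAt.unique_diag`, … (`…FlipTouchLawDiagAudit`, p134990): the hypothesis classes of
  `stub_touchLawDiag` / `stub_identDiag` are inhabited and the window vocabulary is not vacuous.
-/


/-- **The composition.** RL → S0 (tilt form; `StaggerSummedVanishing` by the landed glue) → MESO → N → (A → B → S0 → MESO → N → touch law on diagonal
polygons) → (touch laws → identification on diagonal polygons) → (SLE₆ on diagonal polygons → C) → the crux,
BY NAME: inside `A → B → C`, S0 from RL and B, the touch laws from A, B, S0, MESO, N, identification from the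
touch laws, SLE₆ along diagonal families by the landed `slesixAlong_of_ident`, and C by the transport. -/
theorem ParafermionToSLESixFamilies_of :
    ReturnLaw →
    TiltLawSummed →
    MesoEnvelope →
    DiagHalfPlaneOneArmLower →
    (WeakHolFamilies → PrecompactFamilies → StaggerSummedVanishing → MesoEnvelope →
      DiagHalfPlaneOneArmLower → ∀ D : DobrushinDomain, IsDiagRectilinear D → TouchLawPosDiag D) →
    ((∀ D : DobrushinDomain, IsDiagRectilinear D → TouchLawPosDiag D) → IdentOnDiagRectilinear) →
    ((∀ D : DobrushinDomain, IsDiagRectilinear D → ∀ Λ : ℝ → DiscreteDobrushin, IsFamily D Λ → SLESixAlong D Λ) →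
      SLESixAllFamilies) →
    ParafermionToSLESixFamilies := by
  intro _hRL hS0 hMeso hN hTouch hId hT
  rw [crux_iff]
  intro hA hB
  have hS : StaggerSummedVanishing := staggerSummedVanishing_of_tiltLawSummed hS0
  have hTL : ∀ D : DobrushinDomain, IsDiagRectilinear D → TouchLawPosDiag D := hTouch hA hB hS hMeso hN
  exact hT (slesixAlong_diag_of_ident (hId hTL))

/-- The line closes the crux MODULO ITS STUBS (closure contains `sorryAx` through the six open `stub_*` only —
`stub_returnLaw` is the landed theorem of `…FlipReturnLaw.lean`; this certifies that the hypotheses of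
`ParafermionToSLESixFamilies_of` are literally the stub statements). -/
theorem ParafermionToSLESixFamilies_of_stubs : ParafermionToSLESixFamilies :=
  ParafermionToSLESixFamilies_of stub_returnLaw stub_tiltLawSummed stub_mesoEnvelope stub_diagArmLower
    stub_touchLawDiag stub_identDiag stub_allDomainsOfDiag

end Summit.CriticalPhenomena.CardyFormulaZ2.Cruxes.ParafermionToSLESixFamilies.FlipInvolutionReturnLaw

end
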